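import Summits.NavierStokesRegularity.NavierStokesRegularity.Theses.QuantisedSymmetry
import Summits.NavierStokesRegularity.NavierStokesRegularity.Theorems.QuantisedSymmetryPolyhedralDssProfileExistsDominatesBlowupProfile
import Summits.NavierStokesRegularity.NavierStokesRegularity.Theorems.QuantisedSymmetryLiouvilleKillsProfile
import Literature.Analysis.FluidPDE.TsaiSelfSimilarHolds
import Literature.Analysis.FluidPDE.ChaeWolfRemovingDSSProofs
import Mathlib.Analysis.SpecialFunctions.JapaneseBracket
import HarnessLib

/-!
# Strategist sketch S18g3 — crux `PolyhedralDssProfileExists` (stmt-NavierStokesRegularity-1404)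

Companion of `STRATEGY-CENSUS-s18.md` (family `-s`, independent census, generation 3).
Everything here ELABORATES WITHOUT `sorry`; nothing here is a route item. It records, as checked
Lean, the four switches of the census applied to the fixed crux
`Summit.NavierStokesRegularity.NavierStokesRegularity.Theses.QuantisedSymmetry.PolyhedralDssProfileExists`:

* `crux_iff`, `killSwitch_iff` — the crux and the kill switch (stmt-1405) rewritten per sector `G`;
* DECOMPOSITION `crux_of_split : SectorNonLiouville → SectorPeriodises → crux` (modus ponens,
  proved), with `sectorNonLiouville_of_crux` (the crux gives piece 1, via the landed 1408) and
  `sectorPeriodises_of_killSwitch` (the kill switch gives piece 2 vacuously) — so neither piece is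
  the crux reworded, and neither is ↔ the summit;
* WEAKER INTERMEDIATE `weaker_sectorFree` — the crux dominates the sector-free profile statement
  `Blowup.BlowupTypeIDssProfile` (stmt-0155), in tree;
* STRENGTHENINGS REFUTED: `not_polyhedralSsProfileExists` (continuous self-similar = period → 0:
  Tsai 1998 Thm 1, `tsai_selfsimilar_holds`), `memLp_four_of_profile_decay` (the Type-I profile
  bound puts the profile in `L⁴`, so Tsai's hypothesis is met), `no_profile_near_factor_one`
  (factor window `(1, λ_*(C₀))` empty: Chae–Wolf 2017 Thm 1.3, `chaeWolf2017_removing_dss_holds`);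
* NEGATION `killSwitch_refutes_crux` — the landed 1408.
-/

set_option linter.dupNamespace false

namespace Summit.NavierStokesRegularity.NavierStokesRegularity.Cruxes.PolyhedralDssProfileExists.StrategistS18g3

open MeasureTheory Set
open Literature.Analysis.FluidPDE
open _root_.Summit.NavierStokesRegularity.NavierStokesRegularity.Theses.QuantisedSymmetry
open scoped ENNReal

/-- Physical space. -/
abbrev R3 : Type := EuclideanSpace ℝ (Fin 3)

/-- Linear isometries of physical space (the ambient group of the crux). -/
abbrev Isom : Type := R3 ≃ₗᵢ[ℝ] R3

/-- The polyhedral sector: `G` finite, proper (`det = 1`), irreducible on `ℝ³` (so `G ∈ {T, O, I}`). -/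
def IsPolyhedralSector (G : Subgroup Isom) : Prop :=
  Finite G ∧ (∀ g ∈ G, LinearMap.det (g.toLinearEquiv : R3 →ₗ[ℝ] R3) = 1) ∧
    (∀ V : Submodule ℝ R3, (∀ g ∈ G, ∀ v ∈ V, g v ∈ V) → V = ⊥ ∨ V = ⊤)

/-- The inner block of the crux for a fixed sector `G`: a nontrivial `G`-equivariant Type-I
`λ`-DSS ancient mild solution, some `λ > 1`. -/
def SectorDssProfile (G : Subgroup Isom) : Prop :=
  ∃ c : ℝ, 1 < c ∧ ∃ u : ℝ → R3 → R3, IsAncientMildSolution 1 u ∧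
    (∀ t < 0, AEStronglyMeasurable (u t) volume) ∧ IsDiscretelySelfSimilar c u ∧
      (∃ C₀ : ℝ, HasTypeIDecay C₀ u) ∧ (∀ g ∈ G, ∀ t x, u t (g x) = g (u t x)) ∧
        ¬ (∀ t < 0, u t =ᵐ[volume] 0)

/-- The objects of the kill switch for a fixed sector `G`: a nontrivial `G`-equivariant Type-I
BOUNDED ancient mild solution (no self-similarity). -/
def SectorAncientProfile (G : Subgroup Isom) : Prop :=
  ∃ u : ℝ → R3 → R3, IsBoundedAncientMildSolution 1 u ∧
    (∀ t < 0, AEStronglyMeasurable (u t) volume) ∧ (∃ C₀ : ℝ, HasTypeIDecay C₀ u) ∧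
      (∀ g ∈ G, ∀ t x, u t (g x) = g (u t x)) ∧ ¬ (∀ t < 0, u t =ᵐ[volume] 0)

/-- The crux, sector by sector. -/
theorem crux_iff :
    PolyhedralDssProfileExists ↔ ∃ G : Subgroup Isom, IsPolyhedralSector G ∧ SectorDssProfile G := by
  constructor
  · rintro ⟨G, hfin, hdet, hirr, hrest⟩
    exact ⟨G, ⟨hfin, hdet, hirr⟩, hrest⟩
  · rintro ⟨G, ⟨hfin, hdet, hirr⟩, hrest⟩
    exact ⟨G, hfin, hdet, hirr, hrest⟩

/-- The kill switch (stmt-1405), sector by sector. -/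
theorem killSwitch_iff :
    PolyhedralTypeILiouville ↔ ∀ G : Subgroup Isom, IsPolyhedralSector G → ¬ SectorAncientProfile G := by
  constructor
  · rintro h G ⟨hfin, hdet, hirr⟩ ⟨u, hbd, hmeas, hdec, hsym, hnt⟩
    exact hnt (h G hfin hdet hirr u hbd hmeas hdec hsym)
  · intro h G hfin hdet hirr u hbd hmeas hdec hsym
    by_contra hnt
    exact h G ⟨hfin, hdet, hirr⟩ ⟨u, hbd, hmeas, hdec, hsym, hnt⟩

/-! ## Decomposition (census §Decomposition, split D2 "non-Liouville ∧ periodisation") -/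

/-- Piece P₁ (`SectorNonLiouville`): some polyhedral sector carries a nontrivial Type-I bounded
ancient mild solution — literally the negation of the kill switch (`sectorNonLiouville_iff`). -/
def SectorNonLiouville : Prop :=
  ∃ G : Subgroup Isom, IsPolyhedralSector G ∧ SectorAncientProfile G

/-- Piece P₂ (`SectorPeriodises`, the "closing lemma" of the Leray scaling flow in the sector): a
sector that carries a nontrivial Type-I bounded ancient solution carries a `λ`-DSS one. -/
def SectorPeriodises : Prop :=
  ∀ G : Subgroup Isom, IsPolyhedralSector G → SectorAncientProfile G → SectorDssProfile G

theorem sectorNonLiouville_iff : SectorNonLiouville ↔ ¬ PolyhedralTypeILiouville := by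
  rw [killSwitch_iff]
  simp only [SectorNonLiouville, not_forall, not_not, exists_prop]

/-- ASSEMBLY of the split, proved: P₁ → P₂ → crux. -/
theorem crux_of_split (h₁ : SectorNonLiouville) (h₂ : SectorPeriodises) :
    PolyhedralDssProfileExists := by
  obtain ⟨G, hG, hA⟩ := h₁
  exact crux_iff.2 ⟨G, hG, h₂ G hG hA⟩

/-- P₂ is NOT the crux reworded: the kill switch (consistent with the summit) proves it. -/
theorem sectorPeriodises_of_killSwitch (h : PolyhedralTypeILiouville) : SectorPeriodises :=
  fun G hG hA => absurd hA (killSwitch_iff.1 h G hG)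

/-- NEGATION (census §Negation): the landed kill (stmt-1408,
`quantisedSymmetry_liouvilleKillsProfile_proof`). -/
theorem killSwitch_refutes_crux (h : PolyhedralTypeILiouville) : ¬ PolyhedralDssProfileExists :=
  _root_.Summit.NavierStokesRegularity.NavierStokesRegularity.Theorems.quantisedSymmetry_liouvilleKillsProfile_proof h

/-- P₁ is strictly on the crux's side: the crux gives P₁ (contrapositive of the landed 1408). -/
theorem sectorNonLiouville_of_crux (hX : PolyhedralDssProfileExists) : SectorNonLiouville :=
  sectorNonLiouville_iff.2 fun hL => killSwitch_refutes_crux hL hX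

/-! ## Weaker intermediate (census §Weaker intermediates) -/

/-- W_a: dropping the symmetry clauses lands on the sector-free Type-I DSS profile statement of
route Blowup (stmt-0155) — in tree (`stub_dominatesBlowupProfile`, line `polyhedral_cell`). -/
theorem weaker_sectorFree (hX : PolyhedralDssProfileExists) :
    _root_.Summit.NavierStokesRegularity.NavierStokesRegularity.Theses.Blowup.BlowupTypeIDssProfile :=
  _root_.Summit.NavierStokesRegularity.NavierStokesRegularity.Theorems.PolyhedralDssProfileExists.PolyhedralCell.stub_dominatesBlowupProfile hX

/-- W_λ: the crux pins Tsai's `λ`-DSS Liouville statement at the witness's own factor. -/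
theorem weaker_someFactor (hX : PolyhedralDssProfileExists) : ∃ c : ℝ, 1 < c ∧ ¬ TypeIDSSLiouville c :=
  _root_.Summit.NavierStokesRegularity.NavierStokesRegularity.Theorems.PolyhedralDssProfileExists.PolyhedralCell.exists_not_typeIDSSLiouville_of_polyhedralDssProfileExists hX

/-! ## Strengthenings (census §Strengthen) -/

/-- S⁺₁ — the period-zero (continuous self-similar) strengthening in Leray's profile class: a
nontrivial `G`-equivariant Leray profile `(U, P)` (`ν = 1`, rate `a > 0`) in some `L^q`, `3 < q < ∞`. -/
def PolyhedralSsProfileExists : Prop :=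
  ∃ G : Subgroup Isom, IsPolyhedralSector G ∧ ∃ a : ℝ, 0 < a ∧ ∃ (U : R3 → R3) (P : R3 → ℝ),
    IsLerayProfile 1 a U P ∧ (∀ g ∈ G, ∀ y, U (g y) = g (U y)) ∧
      (∃ q : ℝ≥0∞, 3 < q ∧ q < ⊤ ∧ MemLp U q) ∧ U ≠ 0

/-- S⁺₁ is REFUTED in tree, symmetry or not (Tsai 1998, Thm 1 = `tsai_selfsimilar_holds`). -/
theorem not_polyhedralSsProfileExists : ¬ PolyhedralSsProfileExists := by
  rintro ⟨G, -, a, ha, U, P, hprof, -, ⟨q, hq, hq', hU⟩, hne⟩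
  exact hne (tsai_selfsimilar_holds one_pos ha hprof hq hq' hU)

/-- The Type-I bound of the crux, read on the profile (`t = -1`: `‖U y‖ ≤ C₀ / (‖y‖ + 1)`), puts a
continuous profile in `L⁴(ℝ³)` — so S⁺₁'s integrability clause is implied by the crux's own decay
clause and `not_polyhedralSsProfileExists` really is the period-zero case of the crux. -/
theorem memLp_four_of_profile_decay {U : R3 → R3} (hU : Continuous U) {C₀ : ℝ}
    (hdec : ∀ y, ‖U y‖ ≤ C₀ / (‖y‖ + 1)) : MemLp U 4 (volume : Measure R3) := by
  have hC₀ : 0 ≤ C₀ := by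
    have h0 := hdec 0
    rw [norm_zero, zero_add, div_one] at h0
    exact (norm_nonneg _).trans h0
  have hmeas : AEStronglyMeasurable U (volume : Measure R3) := hU.aestronglyMeasurable
  have hdom : Integrable (fun y : R3 => C₀ ^ (4 : ℝ) * (1 + ‖y‖) ^ (-(4 : ℝ))) (volume : Measure R3) := by
    refine (integrable_one_add_norm ?_).const_mul _
    rw [finrank_euclideanSpace_fin]
    norm_num
  rw [← integrable_norm_rpow_iff hmeas (by norm_num) (by norm_num)]
  have hcont : Continuous fun y : R3 => ‖U y‖ ^ ((4 : ℝ≥0∞).toReal) :=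
    hU.norm.rpow_const fun _ => Or.inr ENNReal.toReal_nonneg
  refine hdom.mono' hcont.aestronglyMeasurable (Filter.Eventually.of_forall fun y => ?_)
  have h1 : 0 < ‖y‖ + 1 := by positivity
  rw [Real.norm_eq_abs, abs_of_nonneg (Real.rpow_nonneg (norm_nonneg _) _), ENNReal.toReal_ofNat]
  calc ‖U y‖ ^ (4 : ℝ) ≤ (C₀ / (‖y‖ + 1)) ^ (4 : ℝ) :=
        Real.rpow_le_rpow (norm_nonneg _) (hdec y) (by norm_num)
    _ = C₀ ^ (4 : ℝ) * (1 + ‖y‖) ^ (-(4 : ℝ)) := by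
        rw [Real.div_rpow hC₀ h1.le, Real.rpow_neg (by positivity), add_comm ‖y‖ 1, div_eq_mul_inv]

/-- S⁺₂ — factor near one: for every Type-I constant `C₀ > 0` the factor window `(1, λ_*(C₀))`
carries no nontrivial classical `λ`-DSS solution (Chae–Wolf 2017 Thm 1.3, PROVED in tree). -/
theorem no_profile_near_factor_one {C₀ : ℝ} (hC₀ : 0 < C₀) :
    ∃ c₁ : ℝ, 1 < c₁ ∧ ∀ c : ℝ, 1 < c → c < c₁ →
      ∀ (u : ℝ → R3 → R3) (p : ℝ → R3 → ℝ), IsClassicalNSSolutionOn (Iio 0) 1 0 u p →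
        IsDiscretelySelfSimilar c u → HasTypeIDecay C₀ u → ∀ t < 0, ∀ x, u t x = 0 :=
  chaeWolf2017_removing_dss_holds C₀ hC₀

end Summit.NavierStokesRegularity.NavierStokesRegularity.Cruxes.PolyhedralDssProfileExists.StrategistS18g3
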